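import Summits.Langlands.Langlands.Theorems.IrreducibilityBySelfDualityIrreducibleOffSectorGDExistenceOfTameCharacter
import Literature.NumberTheory.GaloisRepresentations.UnramifiedKummer
import Literature.NumberTheory.GaloisRepresentations.WildInertia
import Literature.NumberTheory.GaloisRepresentations.TameInertiaCharacterProofs
import Literature.NumberTheory.GaloisRepresentations.WeilGroupFrobeniusPowers
import Literature.Algebra.InverseSystem.AddInverseLimit
import Mathlib.RingTheory.RootsOfUnity.AlgebraicallyClosed
import Mathlib.RingTheory.RootsOfUnity.EnoughRootsOfUnity
import HarnessLib

/-!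
# A character of the inertia group non-trivial on a given open subgroup (the `ℓ`-adic tame
# character), and the Grothendieck–Deligne existence fact, unconditionally
(crux stmt-Langlands-14329 `IrreducibilityBySelfDuality.IrreducibleOffSector`, supports kit
`square-integrable-place`, input (GD); `--supports` file, lead a1)

For a non-archimedean local field `F` with residue characteristic `p ≠ ℓ` and an open subgroup
`U` of the inertia subgroup `I_F` of the Weil group, we construct a homomorphism
`t : I_F →* Multiplicative ℚ̄_ℓ` (an additive `ℚ̄_ℓ`-valued character) which is non-trivial on `U`
(`exists_character_inertia_ne_one`).  It is the `ℓ`-adic tame character: choose compatible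
`ℓ`-power roots `z_m` of a uniformiser `ϖ` (`z_{m+1}^ℓ = z_m`, `z_0 = ϖ`); for `σ ∈ I_F` the
Kummer quotients `σ(z_m)/z_m` are `ℓ^m`-th roots of unity, multiplicative in `σ` because inertia
fixes roots of unity of order prime to `p` (`smul_eq_self_of_pow_eq_one_of_mem_absInertia`), and
compatible (`exists_kummerTower`); they define a homomorphism into `lim_m μ_{ℓ^m}(F̄) ≅ ℤ_ℓ`
(tree: `Literature.Algebra.InverseSystem.addInverseLimit`, `nonempty_addEquiv_padicInt_of_surjective`;
`exists_addMonoidHom_padicInt_of_tower`), composed with `ℤ_ℓ ↪ ℚ_ℓ ↪ ℚ̄_ℓ`.  Non-triviality: some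
`σ₀ ∈ I_F` moves `z_1` by a primitive `ℓ`-th root of unity (`exists_mem_absInertia_smul_eq_mul`:
`F(ϖ^{1/ℓ})/F` is totally ramified), a power `σ₀^k`, `k ≥ 1`, lies in `U`
(`WeilGroup.exists_pow_mem_of_isOpen`), and `ℤ_ℓ ⊂ ℚ̄_ℓ` is torsion-free.  With the landed reduction
`grothendieckDeligne_exists_isWeilDeligneOfLadic_of_exists_character` (p146390) this PROVES the
Literature named fact `GrothendieckDeligne_exists_isWeilDeligneOfLadic`
(`grothendieckDeligne_exists_isWeilDeligneOfLadic_holds`).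
References: Serre, Invent. Math. 15 (1972), §1.3; Serre–Tate 1968, Appendix; Deligne, Antwerp II
§8.4.2; Tate, Corvallis 1979, (4.2.1).
-/

noncomputable section

set_option linter.dupNamespace false

open scoped MatrixGroups Matrix NumberField ValuativeRel
open Module IsDedekindDomain Function
open Literature.NumberTheory.GaloisRepresentations
open Literature.NumberTheory.GaloisRepresentations.IsNonarchimedeanLocalField
open Literature.Algebra.InverseSystem

namespace Summit.Langlands.Langlands.Theorems.IrreducibleOffSector.SquareIntegrablePlace

section TameCharacter

variable (F : Type) [Field F] [ValuativeRel F] [TopologicalSpace F] [IsNonarchimedeanLocalField F]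

omit [ValuativeRel F] [TopologicalSpace F] [IsNonarchimedeanLocalField F] in
/-- **Compatible `ℓ`-power roots.** In the algebraic closure every element `a` has a sequence of
roots `z m` with `z 0 = a` and `z (m+1) ^ ℓ = z m`. [folklore] -/
theorem exists_compatible_pow_roots {ℓ : ℕ} (hℓ : 0 < ℓ) (a : AlgebraicClosure F) :
    ∃ z : ℕ → AlgebraicClosure F, z 0 = a ∧ ∀ m, z (m + 1) ^ ℓ = z m :=
  ⟨fun m => Nat.rec (motive := fun _ => AlgebraicClosure F) a
      (fun _ x => (IsAlgClosed.exists_pow_nat_eq x hℓ).choose) m,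
    rfl, fun _ => (IsAlgClosed.exists_pow_nat_eq _ hℓ).choose_spec⟩

omit [ValuativeRel F] [TopologicalSpace F] [IsNonarchimedeanLocalField F] in
/-- A compatible sequence of `ℓ`-power roots of `a` satisfies `z m ^ ℓ ^ m = a`. [folklore] -/
theorem pow_pow_eq_of_compatible {ℓ : ℕ} {a : AlgebraicClosure F} {z : ℕ → AlgebraicClosure F}
    (h0 : z 0 = a) (h : ∀ m, z (m + 1) ^ ℓ = z m) (m : ℕ) : z m ^ ℓ ^ m = a := by
  induction m with
  | zero => rw [pow_zero, pow_one, h0]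
  | succ m ih => rw [pow_succ', pow_mul, h m, ih]

/-- **The Kummer tower of a uniformiser.**  For `ℓ ≠ p` and a uniformiser `ϖ`: compatible
`ℓ`-power roots `z m` of `ϖ` and, for every `m`, the HOMOMORPHISM `I_F → μ_{ℓ^m}(F̄)`,
`σ ↦ σ(z m)/z m` (multiplicative because inertia fixes the `ℓ^m`-th roots of unity), compatible
under `ζ ↦ ζ^ℓ`. [cite: SerreInventiones1972, §1.3] -/
theorem exists_kummerTower (ℓ : ℕ) [Fact ℓ.Prime] (hℓ : ringChar 𝓀[F] ≠ ℓ) {ϖ : 𝒪[F]}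
    (hϖ : Irreducible ϖ) :
    ∃ (z : ℕ → AlgebraicClosure F)
      (φ : ∀ m : ℕ, ↥(absInertia F) →* ↥(rootsOfUnity (ℓ ^ m) (AlgebraicClosure F))),
      z 1 ^ ℓ = algebraMap 𝒪[F] (AlgebraicClosure F) ϖ ∧ (∀ m, z m ≠ 0) ∧
      (∀ m (σ : absInertia F), (((φ m σ : ↥(rootsOfUnity (ℓ ^ m) (AlgebraicClosure F))) :
          (AlgebraicClosure F)ˣ) : AlgebraicClosure F) = (σ : Field.absoluteGaloisGroup F) • z m / z m) ∧
      (∀ m (σ : absInertia F), ((((φ (m + 1) σ : ↥(rootsOfUnity (ℓ ^ (m + 1)) (AlgebraicClosure F))) :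
          (AlgebraicClosure F)ˣ) : AlgebraicClosure F)) ^ ℓ =
        (((φ m σ : ↥(rootsOfUnity (ℓ ^ m) (AlgebraicClosure F))) : (AlgebraicClosure F)ˣ) :
          AlgebraicClosure F)) := by
  classical
  have hℓp : ℓ.Prime := Fact.out
  have hℓpos : 0 < ℓ := hℓp.pos
  have hpd : ∀ m : ℕ, ¬ ringChar 𝓀[F] ∣ ℓ ^ m := fun m h =>
    hℓ ((Nat.prime_dvd_prime_iff_eq (ringChar_residueField_prime (F := F)) hℓp).mp
      ((ringChar_residueField_prime (F := F)).dvd_of_dvd_pow h))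
  set a : AlgebraicClosure F := algebraMap 𝒪[F] (AlgebraicClosure F) ϖ with ha
  have ha0 : a ≠ 0 := by
    rw [ha, IsScalarTower.algebraMap_apply 𝒪[F] F (AlgebraicClosure F), map_ne_zero,
      map_ne_zero_iff _ (IsFractionRing.injective 𝒪[F] F)]
    exact hϖ.ne_zero
  obtain ⟨z, hz0, hz⟩ := exists_compatible_pow_roots F hℓpos a
  have hzpow : ∀ m, z m ^ ℓ ^ m = a := pow_pow_eq_of_compatible F hz0 hz
  have hzne : ∀ m, z m ≠ 0 := fun m h =>
    ha0 (by rw [← hzpow m, h, zero_pow (pow_ne_zero m hℓp.ne_zero)])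
  have hσa : ∀ σ : Field.absoluteGaloisGroup F, σ • a = a := fun σ => by
    rw [ha, IsScalarTower.algebraMap_apply 𝒪[F] F (AlgebraicClosure F),
      Field.absoluteGaloisGroup.smul_def, AlgEquiv.commutes]
  -- Kummer quotients
  let c : ℕ → Field.absoluteGaloisGroup F → AlgebraicClosure F := fun m σ => σ • z m / z m
  have hc : ∀ m σ, c m σ = σ • z m / z m := fun _ _ => rfl
  have hcpow : ∀ m σ, c m σ ^ ℓ ^ m = 1 := fun m σ => by
    rw [hc, div_pow, ← smul_pow', hzpow m, hσa, div_self ha0]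
  have hcsmul : ∀ m σ, σ • z m = c m σ * z m := fun m σ => by
    rw [hc, div_mul_cancel₀ _ (hzne m)]
  have hfix : ∀ m, ∀ σ ∈ absInertia F, ∀ ζ : AlgebraicClosure F, ζ ^ ℓ ^ m = 1 → σ • ζ = ζ :=
    fun m σ hσ ζ hζ => smul_eq_self_of_pow_eq_one_of_mem_absInertia hσ (pow_pos hℓpos m) (hpd m) hζ
  have hcmul : ∀ m, ∀ σ ∈ absInertia F, ∀ τ : Field.absoluteGaloisGroup F,
      c m (σ * τ) = c m σ * c m τ := fun m σ hσ τ => by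
    have h1 : (σ * τ) • z m = c m σ * c m τ * z m := by
      rw [mul_smul, hcsmul m τ, smul_mul', hfix m σ hσ _ (hcpow m τ), hcsmul m σ]
      ring
    have h2 : c m (σ * τ) * z m = c m σ * c m τ * z m := by rw [← hcsmul, h1]
    exact mul_right_cancel₀ (hzne m) h2
  have hcone : ∀ m, c m 1 = 1 := fun m => by rw [hc, one_smul, div_self (hzne m)]
  have hccompat : ∀ m σ, c (m + 1) σ ^ ℓ = c m σ := fun m σ => by
    rw [hc, hc, div_pow, ← smul_pow', hz m]
  haveI hneN : ∀ m : ℕ, NeZero (ℓ ^ m) := fun m => ⟨pow_ne_zero m hℓp.ne_zero⟩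
  refine ⟨z, fun m =>
    { toFun := fun σ => rootsOfUnity.mkOfPowEq (c m σ) (hcpow m σ)
      map_one' := Subtype.ext (Units.ext (by
        rw [rootsOfUnity.val_mkOfPowEq_coe, Subgroup.coe_one, hcone m, OneMemClass.coe_one,
          Units.val_one]))
      map_mul' := fun σ τ => Subtype.ext (Units.ext (by
        rw [rootsOfUnity.val_mkOfPowEq_coe, Subgroup.coe_mul, hcmul m σ σ.2 τ, Subgroup.coe_mul,
          Units.val_mul, rootsOfUnity.val_mkOfPowEq_coe, rootsOfUnity.val_mkOfPowEq_coe])) },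
    ?_, hzne, fun m σ => rootsOfUnity.val_mkOfPowEq_coe _ _, fun m σ => ?_⟩
  · rw [← hzpow 1, pow_one]
  · change (c (m + 1) σ) ^ ℓ = c m σ
    exact hccompat m σ

omit [ValuativeRel F] [TopologicalSpace F] [IsNonarchimedeanLocalField F] in
/-- **From a compatible tower of `μ_{ℓ^m}`-valued homomorphisms to a `ℤ_ℓ`-valued one.**  A family
of homomorphisms `φ m : A →* μ_{ℓ^m}(F̄)` compatible under `ζ ↦ ζ^ℓ` factors through
`lim_m μ_{ℓ^m}(F̄) ≅ ℤ_ℓ` (`(AlgebraicClosure F)` has all `ℓ`-power roots of unity when `ℓ ≠ char`):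
there is `T : Additive A →+ ℤ_ℓ` with `T a = 0 → φ 1 a = 1`. [folklore] -/
theorem exists_addMonoidHom_padicInt_of_tower (ℓ : ℕ) [Fact ℓ.Prime] [NeZero ((ℓ : ℕ) : F)]
    {A : Type*} [Group A]
    (φ : ∀ m : ℕ, A →* ↥(rootsOfUnity (ℓ ^ m) (AlgebraicClosure F)))
    (hφ : ∀ m (a : A), ((((φ (m + 1) a : ↥(rootsOfUnity (ℓ ^ (m + 1)) (AlgebraicClosure F))) :
        (AlgebraicClosure F)ˣ) : AlgebraicClosure F)) ^ ℓ =
      (((φ m a : ↥(rootsOfUnity (ℓ ^ m) (AlgebraicClosure F))) : (AlgebraicClosure F)ˣ) :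
        AlgebraicClosure F)) :
    ∃ T : Additive A →+ ℤ_[ℓ], ∀ a : A, T (Additive.ofMul a) = 0 → φ 1 a = 1 := by
  classical
  have hℓp : ℓ.Prime := Fact.out
  have hℓpos : 0 < ℓ := hℓp.pos
  haveI hneN : ∀ m : ℕ, NeZero (ℓ ^ m) := fun m => ⟨pow_ne_zero m hℓp.ne_zero⟩
  -- the inverse system `μ_{ℓ^{m+1}} → μ_{ℓ^m}`, `ζ ↦ ζ^ℓ`, additively written
  let μ : ℕ → Type := fun m => ↥(rootsOfUnity (ℓ ^ m) (AlgebraicClosure F))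
  let pw : ∀ m, μ (m + 1) →* μ m := fun m =>
    { toFun := fun ζ => ⟨(ζ : (AlgebraicClosure F)ˣ) ^ ℓ, by
        rw [mem_rootsOfUnity, ← pow_mul, mul_comm, ← pow_succ]
        exact ζ.2⟩
      map_one' := Subtype.ext (by
        change ((1 : μ (m + 1)) : (AlgebraicClosure F)ˣ) ^ ℓ = 1
        rw [OneMemClass.coe_one, one_pow])
      map_mul' := fun x y => Subtype.ext (by
        change ((x * y : μ (m + 1)) : (AlgebraicClosure F)ˣ) ^ ℓ =
          ((x : (AlgebraicClosure F)ˣ) ^ ℓ) * ((y : (AlgebraicClosure F)ˣ) ^ ℓ)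
        rw [Subgroup.coe_mul, mul_pow]) }
  have hpw : ∀ m (ζ : μ (m + 1)), ((pw m ζ : (AlgebraicClosure F)ˣ) : AlgebraicClosure F) =
      ((ζ : (AlgebraicClosure F)ˣ) : AlgebraicClosure F) ^ ℓ := fun m ζ => by
    change (((ζ : (AlgebraicClosure F)ˣ) ^ ℓ : (AlgebraicClosure F)ˣ) : AlgebraicClosure F) = _
    rw [Units.val_pow_eq_pow_val]
  let G : ℕ → Type := fun m => Additive (μ m)
  let tr : ∀ m, G (m + 1) →+ G m := fun m => MonoidHom.toAdditive (pw m)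
  -- surjective transitions
  have hsurj : ∀ m, Surjective (tr m) := by
    intro m η
    set η' : μ m := Additive.toMul η with hη'
    obtain ⟨x, hx⟩ := IsAlgClosed.exists_pow_nat_eq
      (((η' : (AlgebraicClosure F)ˣ) : AlgebraicClosure F)) hℓpos
    have hx0 : x ≠ 0 := fun h => by
      rw [h, zero_pow hℓp.ne_zero] at hx
      exact (Units.ne_zero _) hx.symm
    have hxmem : Units.mk0 x hx0 ∈ rootsOfUnity (ℓ ^ (m + 1)) (AlgebraicClosure F) := by
      rw [mem_rootsOfUnity, Units.ext_iff, Units.val_pow_eq_pow_val, Units.val_mk0, pow_succ',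
        pow_mul, hx, ← Units.val_pow_eq_pow_val, Units.val_one]
      have hη1 : (η' : (AlgebraicClosure F)ˣ) ^ ℓ ^ m = 1 := (mem_rootsOfUnity _ _).mp η'.2
      rw [hη1, Units.val_one]
    refine ⟨Additive.ofMul (⟨Units.mk0 x hx0, hxmem⟩ : μ (m + 1)), ?_⟩
    change Additive.ofMul (pw m ⟨Units.mk0 x hx0, hxmem⟩) = η
    rw [← ofMul_toMul η]
    congr 1
    refine Subtype.ext (Units.ext ?_)
    rw [hpw, ← hη']
    exact hx
  -- each level is cyclic of order `ℓ^m`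
  have hcard : ∀ m, Nat.card (G m) = ℓ ^ m := fun m =>
    HasEnoughRootsOfUnity.natCard_rootsOfUnity (AlgebraicClosure F) (ℓ ^ m)
  let e : ∀ m, G m ≃+ ZMod (ℓ ^ m) := fun m =>
    ((zmodAddCyclicAddEquiv (G := G m) (isAddCyclic_additive_iff.2 inferInstance)).symm).trans
      (ZMod.ringEquivCongr (hcard m)).toAddEquiv
  obtain ⟨E⟩ := nonempty_addEquiv_padicInt_of_surjective (t := tr) (p := ℓ) e hsurj
  -- the compatible family `φ`, additively, and its factorisation through the limit
  let φ' : ∀ m, Additive A →+ G m := fun m => MonoidHom.toAdditive (φ m)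
  have hφ' : ∀ m x, tr m (φ' (m + 1) x) = φ' m x := fun m x => by
    change Additive.ofMul (pw m (φ (m + 1) (Additive.toMul x))) =
      Additive.ofMul (φ m (Additive.toMul x))
    congr 1
    refine Subtype.ext (Units.ext ?_)
    rw [hpw]
    exact hφ m (Additive.toMul x)
  -- the universal map into the limit (the tree's `addInverseLimit.lift` wants a commutative source;
  -- `A` need not be, so the three-line construction is repeated)
  let κ : Additive A →+ addInverseLimit tr :=
    { toFun := fun a => ⟨fun m => φ' m a, fun m => hφ' m a⟩
      map_zero' := Subtype.ext (funext fun m => map_zero (φ' m))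
      map_add' := fun a b => Subtype.ext (funext fun m => map_add (φ' m) a b) }
  have hκproj : ∀ a, addInverseLimit.proj tr 1 (κ a) = φ' 1 a := fun _ => rfl
  refine ⟨E.toAddMonoidHom.comp κ, fun a ha0 => ?_⟩
  have hκ : κ (Additive.ofMul a) = 0 := E.injective (by rw [map_zero]; exact ha0)
  have h1 : addInverseLimit.proj tr 1 (κ (Additive.ofMul a)) = 0 := by rw [hκ, map_zero]
  rw [hκproj] at h1
  exact congrArg Additive.toMul h1

/-- **The `ℓ`-adic tame character, abstractly: a character of inertia non-trivial on a given open
subgroup.**  For `ℓ ≠ p` (the residue characteristic of `F`) and an open subgroup `U` of the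
inertia subgroup of `W_F` there is a homomorphism `t : I_F →* Multiplicative ℚ̄_ℓ` and `u ∈ U` with
`t u ≠ 1`. [cite: SerreInventiones1972, §1.3] -/
theorem exists_character_inertia_ne_one (ℓ : ℕ) [Fact ℓ.Prime] (hℓ : ringChar 𝓀[F] ≠ ℓ)
    (U : Subgroup (WeilGroup F)) (_hU : U ≤ WeilGroup.inertia F)
    (hUo : IsOpen (U : Set (WeilGroup F))) :
    ∃ (t : WeilGroup.inertia F →* Multiplicative (PadicAlgCl ℓ)) (u : WeilGroup.inertia F),
      (u : WeilGroup F) ∈ U ∧ t u ≠ 1 := by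
  classical
  have hℓp : ℓ.Prime := Fact.out
  have hℓpos : 0 < ℓ := hℓp.pos
  haveI hneF : NeZero ((ℓ : ℕ) : F) := neZero_natCast_of_not_ringChar_dvd (F := F) (fun h =>
    hℓ ((Nat.prime_dvd_prime_iff_eq (ringChar_residueField_prime (F := F)) hℓp).mp h))
  obtain ⟨ϖ, hϖ⟩ := IsDiscreteValuationRing.exists_irreducible 𝒪[F]
  obtain ⟨z, φ, hz1, hzne, hφval, hφcompat⟩ := exists_kummerTower F ℓ hℓ hϖ
  obtain ⟨T, hT⟩ := exists_addMonoidHom_padicInt_of_tower F ℓ φ hφcompat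
  -- `ℤ_ℓ ↪ ℚ̄_ℓ`
  let ι : ℤ_[ℓ] →+* PadicAlgCl ℓ := (algebraMap ℚ_[ℓ] (PadicAlgCl ℓ)).comp PadicInt.Coe.ringHom
  have hιinj : Injective ι := (algebraMap ℚ_[ℓ] (PadicAlgCl ℓ)).injective.comp
    (fun x y h => PadicInt.ext (by simpa using h))
  let ψ : Additive ↥(absInertia F) →+ PadicAlgCl ℓ := ι.toAddMonoidHom.comp T
  -- from the Weil group's inertia to `absInertia F`
  let j : ↥(WeilGroup.inertia F) →* ↥(absInertia F) :=
    { toFun := fun w => ⟨WeilGroup.toAbsGalois F w, WeilGroup.mem_inertia_iff.mp w.2⟩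
      map_one' := Subtype.ext (by simp)
      map_mul' := fun x y => Subtype.ext (by simp) }
  let t : ↥(WeilGroup.inertia F) →* Multiplicative (PadicAlgCl ℓ) :=
    { toFun := fun w => Multiplicative.ofAdd (ψ (Additive.ofMul (j w)))
      map_one' := by simp
      map_mul' := fun x y => by simp [ofAdd_add] }
  -- an inertia element moving `z 1` by a primitive `ℓ`-th root of unity
  obtain ⟨ζ, hζ⟩ := HasEnoughRootsOfUnity.exists_primitiveRoot (AlgebraicClosure F) ℓ
  obtain ⟨σ₀, hσ₀I, hσ₀⟩ := exists_mem_absInertia_smul_eq_mul hℓpos hϖ hz1 hζ.pow_eq_one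
  have hc1 : (((φ 1 ⟨σ₀, hσ₀I⟩ : ↥(rootsOfUnity (ℓ ^ 1) (AlgebraicClosure F))) :
      (AlgebraicClosure F)ˣ) : AlgebraicClosure F) = ζ := by
    rw [hφval]
    change σ₀ • z 1 / z 1 = ζ
    rw [hσ₀, mul_div_assoc, div_self (hzne 1), mul_one]
  let w₀ : WeilGroup F := WeilGroup.mk σ₀ ⟨0, isFrobPow_zero_iff_mem_absInertia.mpr hσ₀I⟩
  have hw₀ : WeilGroup.toAbsGalois F w₀ = σ₀ := WeilGroup.toAbsGalois_mk _ _
  have hw₀I : w₀ ∈ WeilGroup.inertia F := by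
    rw [WeilGroup.mem_inertia_iff, hw₀]
    exact hσ₀I
  obtain ⟨k, hk, hkU⟩ := WeilGroup.exists_pow_mem_of_isOpen U hUo hw₀I
  refine ⟨t, ⟨w₀ ^ k, pow_mem hw₀I k⟩, hkU, ?_⟩
  have hjw : j ⟨w₀ ^ k, pow_mem hw₀I k⟩ = ⟨σ₀, hσ₀I⟩ ^ k := by
    refine Subtype.ext ?_
    change WeilGroup.toAbsGalois F (w₀ ^ k) = ((⟨σ₀, hσ₀I⟩ ^ k : ↥(absInertia F)) : _)
    rw [map_pow, hw₀, SubgroupClass.coe_pow]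
  have hψ0 : ψ (Additive.ofMul ⟨σ₀, hσ₀I⟩) ≠ 0 := by
    intro h0
    have hT0 : T (Additive.ofMul ⟨σ₀, hσ₀I⟩) = 0 :=
      hιinj (by rw [map_zero]; exact h0)
    have h2 := hT ⟨σ₀, hσ₀I⟩ hT0
    have h3 : (((φ 1 ⟨σ₀, hσ₀I⟩ : ↥(rootsOfUnity (ℓ ^ 1) (AlgebraicClosure F))) :
        (AlgebraicClosure F)ˣ) : AlgebraicClosure F) = 1 := by
      rw [h2, OneMemClass.coe_one, Units.val_one]
    rw [hc1] at h3
    exact hζ.ne_one hℓp.one_lt h3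
  intro ht
  have h4 : ψ (Additive.ofMul (j ⟨w₀ ^ k, pow_mem hw₀I k⟩)) = 0 := by
    have := congrArg Multiplicative.toAdd ht
    simpa [t] using this
  rw [hjw, ofMul_pow, map_nsmul] at h4
  exact smul_ne_zero hk.ne' hψ0 h4

/-- **Grothendieck–Deligne existence, unconditionally**: the Literature named fact
`GrothendieckDeligne_exists_isWeilDeligneOfLadic` holds (the landed reduction
`grothendieckDeligne_exists_isWeilDeligneOfLadic_of_exists_character` fed with
`exists_character_inertia_ne_one`). [cite: DeligneAntwerpII1973, §8.4.2]
[cite: TateCorvallis1979, (4.2.1)] [cite: SerreTate1968, Appendix] -/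
theorem grothendieckDeligne_exists_isWeilDeligneOfLadic_holds :
    GrothendieckDeligne_exists_isWeilDeligneOfLadic :=
  grothendieckDeligne_exists_isWeilDeligneOfLadic_of_exists_character
    fun F _ _ _ _ ℓ _ hℓ U hU hUo => exists_character_inertia_ne_one F ℓ hℓ U hU hUo

end TameCharacter

end Summit.Langlands.Langlands.Theorems.IrreducibleOffSector.SquareIntegrablePlace

end
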